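import Literature.MathematicalPhysics.QuantumFieldTheory.King1986.TopScalePiece
import Summits.QuantumFields.YangMills.Theorems.BalabanUVNodesN15KingModelReadout
import Summits.QuantumFields.YangMills.Theorems.BalabanUVNodesN18KingModel

/-!
# BalabanUVNodes ∕ N15 — THE KING-MODEL RUNG, PART 1: NE2's OPERATOR and SITE layers DECIDED in King's `A = 0` model for
# King's PROPAGATOR TOP-SCALE PIECE `G^η_{(K)} = C^η − G^η_K` under King's TWO-LATTICE pairing, on Bałaban's volumes
# (Track A, DAG node N15 = NE2; FAN-OUT v1.1 §N15 s3 «KING-MODEL ∕ RIEMANN-KERNEL RUNG»)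

HONEST FRAMING.  Count-neutral kernel bookkeeping (cell `pub-ymgap`, seat `pub-ymgap-dag-n15-e` g0, strategy s3 «alternative
currency»; `--supports stmt-QuantumFields-19676` = K3 `SpineGivenEndpointR11`).  King's `A = 0` SCALAR MODEL ([King1986], TEMPLATE
literature, printed AND proved; its torus theorems are the tree's `King1986.Torus.*`, seats n18-b ∕ pub-balaban) — NOT Bałaban's
covariant propagators `G(U)` of [Balaban1985BackgroundPropagators] Thm 3.1, for which NE2⁺ is NOT PRINTED and not proved; NOT a node
discharge; finite tori; nothing continuum ∕ ℝ⁴ ∕ OS ∕ mass-gap ∕ Clay.  0 `sorry`, standard axioms; the `def`s are plumbing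
(an index, a carrier map, kernels written out).

THE POINT («NE2 in King's model», the operator ∕ site half; the unit-lattice layer and the packaged node statement are PART 2,
`BalabanUVNodesN15KingModelRungUnit`).  Node N15's statement of record is the three NE2⁺ layers of `T4EtaRate` on ONE family of
paired instances (`YMDAG.UVSplit.N15At`: `NE2PlusOperator ∧ NE2PlusSite 4 p ∧ NE2PlusUnit`) — η-DIFFERENCE estimates with King's
rate factor for the background propagators ([B9] (3.42)), the `𝔅`-kernels (Thm 3.2 (3.48)) and `C^{(k)}(Λ)` (Thm 3.15).  IN PRINT
the only η-rates of block-RG propagators are King's, `A = 0` ([King1986] Props. 3.8–3.9, Lemmas 4.3–4.5; `T4EtaRate` header).  The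
tree's knit of record (`NE2NodeTorus.n15_knit_LG`, seat n15-a) decides the node shape for the Landau-gauge VECTOR linear theory at
`U ≡ 1` with King-SHAPED rate theorems; THIS FILE decides NE2's operator and site layers for KING'S OWN PROPAGATOR PIECE, by name
from King's printed theorems as kernel-checked in `King1986/TopScalePiece` (3a0d726442db):
*"Finally, we must establish Propositions 3.7 and 3.9 for G^η_{(K)} = C^η − G^η_K … (4.44) … Proposition 3.9 holds for G^η_{(K)}
from the convergence of C^ηQ^*_K and a_KQ_KG^η_K"* (p. 675).  Concretely, for `d + 1 ≥ 1`, odd `L ≥ 3`, `a > 0`, `m² > 0`,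
`0 < γ ≤ 1`:
* §1 DISTANCE DICTIONARY + A TWO-POINT READOUT on the knit lineage's operator carrier `T4EtaRateOperatorTorus.torusOpGeo` (sites =
  unit torus, test functions on it): the tree's readout `opKernelFamily` needs a ONE-variable convolution kernel; King's
  `G^η_{(K)}(x, y)` read at the base points of two unit blocks is a genuine TWO-point kernel `K(b, b′)`, so `opKernelFamily₂ K`
  realises the four (3.42) entries of `λ ↦ Σ_z K(·, z)λ(z)` (`|Kλ|`, `Σ_μ|∇_μKλ|`, `Σ_μ|K∇*_μλ|`, `|ΔKλ|`, unit-lattice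
  derivatives = the covariant ones at `U ≡ 1`) and **`etaRateIneq342_of_kernelBound₂`**: a kernel bound
  `|K(y, z)| ≤ A·e^{−δ|y − z|_T}·(L^{−γ})^k` gives `EtaRateIneq342 (opKernelFamily₂ K) (4(d+1)e^{δ}A) δ γ` (point-supported
  arguments collapse the sum; each entry sees ≤ 4(d+1) kernel values one unit step away; `e^{δ}` per step).
* §2 KING-VOLUME CARRIERS: index `KingVolIndex` = (volume exponent `m`, level `K ≥ 1`, [B9] size letter `Msz ≥ 1`);
  `kingVolInstance` = the EXISTING `torusOpInstance` at the unit torus `Π_μ ℤ∕(2L^m)` (= `Params.sitesPerDir K`, Bałaban's volume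
  of [Balaban1987RG1] (0.1)) with `K` coarse scales (`η = L^{−K}`), fine run `K + 1`, identity pairing on unit sites, one-point
  backgrounds — a sub-family of the knit lineage's carriers, no new geometry.
* §3 THE OBJECT: `topPieceBase L N M a m² K b b′ = G^η_{(K)}(base b, base b′)` (`King1986.Torus.topPiece`, (2.17)∕(4.44), at the
  base points `L^K·b` of the unit blocks — King's pairing convention p. 664 *"When x′ ∈ T_{η′}, we denote by x that point in T_η
  for which x′ ∈ B^n(x)"*: base points lie over base points, `basePt_over`), `topPieceStep` = level `K + 1` minus level `K`,
  `topPieceSite` ∕ `topPieceOp` the site kernel and the operator family it defines.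
* §4 **`topPiece_step_le`** — ONE `(C, δ)` in `(d, L, a, m², γ)` with `|G_{(K+1)}(base b, base b′) − G_{(K)}(base b, base b′)| ≤
  C·e^{−δ|b − b′|_T}·(L^{−γ∕2})^K` for EVERY `K ≥ 1`, EVERY volume, all unit sites: `topPiece_rate_blocks` (n = 1) with the
  `K`-dependence of King's constants majorised by `N18KingModel.prop38Const_le_unif` and `(L^K)⁻¹ ≤ (L^{−γ∕2})^K`.
* §5 THE LAYERS: **`ne2PlusSite_topPiece`** ∕ `ne2ZeroSite_topPiece` (`NE2PlusSite d′ p c35`, every exponent pair, rate `γ∕2`,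
  guards `M₅ = a₀ = 1`) and **`ne2PlusOperator_topPiece`** ∕ `ne2ZeroOperator_topPiece` (constant `4(d+1)e^{δ}C`) on
  `kingVolInstance d L`, HYPOTHESIS-FREE.  The letters have content: `δ > 0`, `0 < L^{−γ∕2} < 1`, uniform in `(m, K, Msz)`; the
  index is inhabited (`kingVolIndex_nonempty`); the [B9] size letter is a free coordinate, so the guard `M₅ ≤ M` is not why the
  shapes hold (cf. n15-a `VectorPieceSized`).
WHAT THE CURVED CASE ADDS (one line; PART 2 records it as a kernel remark): Bałaban's NE2⁺ asks these inequalities for the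
`U`-DEPENDENT covariant `G(U)` on the multiscale domain tower `𝔅 = ⋃_j Λ_j` with the `(L^jη)^{−p}` prefactors of sites of all
scales, UNIFORMLY over the LIVE regularity window `Reg335 ∕ Reg336 c35 α₀ U` ([B9] (3.35)–(3.36)) — the model's background sort
is one point and its tower has one scale; the background control in print is analyticity in `U` ([B9] Thm 3.4, tree
`B9.Thm34Printed`) and uniformity in `η`, never an η-difference (`T4EtaRate` header, GAPS G-t4-U1a-1).
HONEST SCOPE.  (i) `A = 0`: every `NE2Plus…` conclusion below quantifies its background over `{U ≡ 1}` (NE2⁰ content inside the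
NE2⁺ type); (ii) single top scale: the fine lattice is read at block base points (the knit lineage's collapse, `NE2NodeTorus`
HONEST SCOPE (ii)); King's Prop. 3.9 compares POINT values over points, so the block Riemann sums of the row's «U ≡ 1 input»
(`N15RiemannKernel`) follow by averaging and are not needed; (iii) objects = King's scalar `G^η_{(K)}` on Bałaban's volumes
`M_μ = 2L^m`, odd `L ≥ 3` (the standing hypotheses of `King1986.Torus.topPiece_rate_blocks`); the single-scale pieces
`G^η_{(j)}`, `j < K`, with their `(L^jη)^{2−d−γ}` prefactors (Prop. 3.9 (3.73)) need the multiscale carrier (NODE 00's object)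
and are not read here.  Locators: [King1986] CMP 102 (1986): (2.17) p. 653, p. 664 (pairing), Prop. 3.7 (3.64) p. 663,
Prop. 3.9 (3.73) p. 665, (4.44) p. 675; [B9] = [Balaban1985BackgroundPropagators] CMP 99 (1985): (3.35)–(3.36) p. 396, Thm 3.1
(3.42) p. 397, Thm 3.2 (3.48) p. 398, Thm 3.4 p. 400, Thm 3.14 pp. 426–427 (typing template).
-/

noncomputable section

namespace Summit.QuantumFields.YangMills.BalabanUVNodes.N15KingModelRung

open Real Finset
open Literature.MathematicalPhysics.QuantumFieldTheory.Balaban1983to89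
open Literature.MathematicalPhysics.QuantumFieldTheory.Balaban1983to89.T4EtaRate (PairedInstance EtaRateIneq342 EtaRateIneqSite
  NE2PlusOperator NE2PlusSite NE2ZeroOperator ne2Zero_of_ne2Plus rateFactor)
open Literature.MathematicalPhysics.QuantumFieldTheory.Balaban1983to89.T4EtaRateSiteOfRatePair (NE2ZeroSite)
open Literature.MathematicalPhysics.QuantumFieldTheory.Balaban1983to89.T4EtaRateSiteTorus (TorusIndex torusSupNorm_rep_toT)
open Literature.MathematicalPhysics.QuantumFieldTheory.Balaban1983to89.T4EtaRateOperatorTorus (torusOpGeo torusOpInstance fdiffT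
  fdiffAdjT lapT B0op B0op_pos abs_le_supNorm_op supNorm_op_nonneg torusOpGeo_len torusOpGeo_dist rateFactor_torusOpGeo pref4_one)
open Literature.MathematicalPhysics.QuantumFieldTheory.Balaban1983to89.T4EtaRateDefectSite (pt9Bg)
open Literature.MathematicalPhysics.QuantumFieldTheory.Balaban1983to89.B5Prop11Plancherel (Tor fine unitVec)
open Literature.MathematicalPhysics.QuantumFieldTheory.Balaban1983to89.B6LowerBound2153Torus (toT rep toT_rep)
open Literature.MathematicalPhysics.QuantumFieldTheory.Balaban1983to89.B4TorusKernel.MultiPeriod (torusSupNorm)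
open Literature.MathematicalPhysics.QuantumFieldTheory.King1986 (aK prop38RateConst prop38PosConst lemma43Const)
open Literature.MathematicalPhysics.QuantumFieldTheory.King1986.Torus (topPiece site val_site blockOf blockOf_site tdistT
  tdistT_triangle tdistT_symm tdistT_add_unitVec_le tdistT_sub_unitVec_le tdistT_nonneg topPiece_rate_blocks)
open Summit.QuantumFields.YangMills.BalabanUVNodes.N18KingModel (prop38Const_le_unif kingTheta_pos kingTheta_lt_one
  kingTheta_le_one rpow_neg_natPow kingTheta_eq_sq)

variable {d : ℕ}

/-! ## §2 King-volume carriers: the operator carrier of the knit lineage at Bałaban's volumes `Π_μ ℤ∕(2L^m)`, `K` scales -/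

/-- THE INDEX of the King-model family: volume exponent `m` (unit torus with `2L^m` sites per direction), number of coarse scales
`K ≥ 1` (King's levels start at `k = 1`, (2.13)), and the [B9] size letter `Msz ≥ 1` (free; carried so that the guard `M₅ ≤ M` of
the packaged shapes reads over all sizes). [cite: King1986, (2.13) p.653; Balaban1987RG1, (0.1) p.251 (the volume)] -/
structure KingVolIndex (d : ℕ) where
  /-- volume exponent -/
  m : ℕ
  /-- number of coarse scales -/
  K : ℕ
  one_le_K : 1 ≤ K
  /-- the [B9] size letter -/
  Msz : ℝ
  one_le_Msz : 1 ≤ Msz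

/-- The index type is inhabited (`m = 0`, `K = 1`, `Msz = 1`). [folklore] -/
theorem kingVolIndex_nonempty (d : ℕ) : Nonempty (KingVolIndex d) := ⟨⟨0, 1, le_rfl, 1, le_rfl⟩⟩

/-- The unit torus of the index: `2L^m` sites in every direction (Bałaban's `T₁^{(K)}` of (0.1) at `ε = L^{−K}`). [cite: Balaban1987RG1, (0.1) p.251] -/
def kingVol (L : ℕ) (j : KingVolIndex d) : Fin (d + 1) → ℕ := fun _ => 2 * L ^ j.m

/-- All periods are nonzero (`L ≠ 0`). [folklore] -/
theorem kingVol_neZero (L : ℕ) [NeZero L] (j : KingVolIndex d) : ∀ μ, NeZero (kingVol L j μ) :=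
  fun _ => ⟨mul_ne_zero two_ne_zero (pow_ne_zero _ (NeZero.ne L))⟩

/-- Bałaban's parameter record `(d+1, L, m, K)` of the index (odd `L > 1`). [cite: Balaban1987RG1, (0.1) p.251] -/
abbrev KingVolIndex.params (L : ℕ) (hLodd : Odd L) (hL : 2 ≤ L) (j : KingVolIndex d) : Params :=
  ⟨d + 1, L, j.m, j.K, Nat.succ_pos d, hLodd, by omega⟩

/-- The index's torus IS Bałaban's volume: `2L^m = sitesPerDir K` (= `2L^{m+K−K}`). [cite: Balaban1987RG1, (0.1) p.251] -/
theorem kingVol_eq_sitesPerDir (L : ℕ) (hLodd : Odd L) (hL : 2 ≤ L) (j : KingVolIndex d) :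
    ∀ μ, kingVol L j μ = (j.params L hLodd hL).sitesPerDir (j.params L hLodd hL).K := by
  intro μ
  simp [kingVol, Params.sitesPerDir]

/-- The index read as the knit lineage's torus index `(k, N, M) = (K, 2L^m, Msz)`. [folklore] -/
def kingVolTorusIndex (L : ℕ) [NeZero L] (j : KingVolIndex d) : TorusIndex d :=
  @TorusIndex.mk d j.K (kingVol L j) j.Msz j.one_le_Msz (kingVol_neZero L j)

/-- THE KING-MODEL FAMILY OF PAIRED INSTANCES: the operator carriers `T4EtaRateOperatorTorus.torusOpInstance` (sites = the unit torus
`Π_μ ℤ∕(2L^m)`, test functions on it, coarse run `K` scales at `η = L^{−K}`, fine run `K + 1`, identity pairing on unit sites,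
one-point backgrounds) at the King-volume indices. [cite: King1986, p.664 (pairing convention); Balaban1985BackgroundPropagators, (3.41)–(3.42) p.397 (carrier conventions)] -/
def kingVolInstance (d L : ℕ) [NeZero L] : KingVolIndex d → PairedInstance :=
  fun j => torusOpInstance d (L := (L : ℝ)) (Nat.cast_ne_zero.mpr (NeZero.ne L)) (kingVolTorusIndex L j)

/-! ## §3 The object: King's top-scale piece `G^η_{(K)}` read at the base points of unit blocks -/

section Object

variable (L : ℕ) [NeZero L]

/-- The BASE POINT `N·b` of the unit block `b` on the fine torus with `N` sites per unit block side. [cite: King1986, p.664 (pairing convention)] -/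
def basePt (Nf : ℕ) [NeZero Nf] (M : Fin (d + 1) → ℕ) (b : Tor M) : Tor (fine Nf M) :=
  site Nf M b (fun _ => ⟨0, Nat.pos_of_ne_zero (NeZero.ne Nf)⟩)

/-- The base point of block `b` lies in block `b`. [folklore] -/
theorem blockOf_basePt (Nf : ℕ) [NeZero Nf] (M : Fin (d + 1) → ℕ) [∀ μ, NeZero (M μ)] (b : Tor M) :
    blockOf Nf M (basePt Nf M b) = b :=
  blockOf_site Nf M b _

/-- **BASE POINTS LIE OVER BASE POINTS** under King's pairing `x_μ = ⌊x′_μ∕L⌋` (level `K` under level `K + 1`):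
`L^K·b_μ = (L·L^K·b_μ)∕L`. [cite: King1986, p.664 (pairing convention)] -/
theorem basePt_over (K : ℕ) (M : Fin (d + 1) → ℕ) [∀ μ, NeZero (M μ)] (b : Tor M) (μ : Fin (d + 1)) :
    (basePt (L ^ K) M b μ).val = (basePt (L ^ 1 * L ^ K) M b μ).val / L ^ 1 := by
  haveI : NeZero (L ^ 1 * L ^ K) := ⟨mul_ne_zero (pow_ne_zero _ (NeZero.ne L)) (pow_ne_zero _ (NeZero.ne L))⟩
  rw [basePt, basePt, val_site, val_site]
  simp only [add_zero, pow_one]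
  rw [mul_assoc, Nat.mul_div_cancel_left _ (Nat.pos_of_ne_zero (NeZero.ne L))]

/-- KING'S TOP-SCALE PIECE AT BASE POINTS: `G^η_{(K)}(L^K b, L^K b′)` for the volume `M`, fine level `N = L^K`, constants `a_K = aK a L K`,
`c = N²` (King's `η^{2−d}`-normalisation in the conventions of `King1986.Torus.topPiece`), mass `m²`. [cite: King1986, (2.17) p.653, (4.44) p.675] -/
def topPieceBase (Nf : ℕ) [NeZero Nf] (M : Fin (d + 1) → ℕ) [∀ μ, NeZero (M μ)] (a m2 : ℝ) (K : ℕ) (b b' : Tor M) : ℝ :=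
  topPiece Nf M (aK a L K) (((Nf : ℕ) : ℝ) ^ 2) m2 (basePt Nf M b) (basePt Nf M b')

/-- THE η-DIFFERENCE KERNEL OF THE TOP PIECE at index `j`: level `K + 1` (fine torus `L·L^K` sites per block side) minus level `K`, at
the base points of the unit sites `b, b′`. [cite: King1986, Prop. 3.9 (3.73) p.665 and p.675 (object)] -/
def topPieceStep (a m2 : ℝ) (j : KingVolIndex d) (b b' : Tor (kingVol L j)) : ℝ :=
  haveI := kingVol_neZero L j
  topPieceBase L (L ^ 1 * L ^ j.K) (kingVol L j) a m2 (j.K + 1) b b' - topPieceBase L (L ^ j.K) (kingVol L j) a m2 j.K b b'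

/-- The top piece's η-difference as a SITE kernel on the King-model family. [cite: Balaban1985BackgroundPropagators, Thm 3.2 (3.48) p.398 (shape); King1986, p.675 (object)] -/
def topPieceSite (a m2 : ℝ) : ∀ j : KingVolIndex d, B9.SiteKernel (kingVolInstance d L j).gc (kingVolInstance d L j).Bf :=
  fun j => ⟨fun _ b b' => topPieceStep L a m2 j b b'⟩

/-- The top piece's η-difference as an OPERATOR family (four (3.42) entries) on the King-model family. [cite: Balaban1985BackgroundPropagators, (3.42) p.397 (shape); King1986, p.675 (object)] -/
def topPieceOp (a m2 : ℝ) : ∀ j : KingVolIndex d, B9.KernelFamily (kingVolInstance d L j).gc (kingVolInstance d L j).Bf :=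
  fun j =>
    haveI := kingVol_neZero L j
    opKernelFamily₂ (N := kingVol L j) (topPieceStep L a m2 j) (L : ℝ) j.Msz j.K

end Object

/-! ## §4 The step bound: ONE constant for all levels and volumes -/

section Step

variable (L : ℕ) [NeZero L]

omit [NeZero L] in
/-- `(L^K)⁻¹ ≤ (L^{−γ∕2})^K` for `L ≥ 1`, `γ ≤ 2`. [folklore] -/
theorem inv_pow_le_theta_pow (hL : 1 ≤ L) {γ : ℝ} (hγ : γ ≤ 2) (K : ℕ) :
    ((L : ℝ) ^ K)⁻¹ ≤ ((L : ℝ) ^ (-(γ / 2))) ^ K := by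
  have hL1 : (1 : ℝ) ≤ L := by exact_mod_cast hL
  rw [← inv_pow, ← Real.rpow_neg_one]
  exact pow_le_pow_left₀ (Real.rpow_nonneg (by linarith) _) (Real.rpow_le_rpow_of_exponent_le hL1 (by linarith)) K

/-- **THE TWO-SPACING RATE OF THE TOP PIECE AT BASE POINTS, UNIFORMLY**: for odd `L ≥ 3`, `a > 0`, `m² > 0`, `0 < γ ≤ 1` there are
`C, δ > 0` (functions of `d, L, a, m², γ`) with `|G_{(K+1)}(L^{K+1}b, L^{K+1}b′) − G_{(K)}(L^Kb, L^Kb′)| ≤ C·e^{−δ|b − b′|_T}·(L^{−γ∕2})^K`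
for EVERY index (every volume `2L^m`, every `K ≥ 1`) and all unit sites — `King1986.Torus.topPiece_rate_blocks` at `n = 1` («Proposition
3.9 holds for G^η_{(K)}», p. 675), the `K`-dependence of its constant majorised by `N18KingModel.prop38Const_le_unif`, the `(L^K)⁻¹`
term absorbed by `inv_pow_le_theta_pow`. [cite: King1986, Prop. 3.9 (3.73) p.665, p.675, Prop. 3.8 (3.71) p.664] -/
theorem topPiece_step_le (hLodd : Odd L) (hL : 2 ≤ L) {a m2 : ℝ} (ha : 0 < a) (hm : 0 < m2) {γ : ℝ} (hγ0 : 0 < γ)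
    (hγ1 : γ ≤ 1) :
    ∃ C δ : ℝ, 0 < C ∧ 0 < δ ∧ ∀ (j : KingVolIndex d) (b b' : Tor (kingVol L j)),
      haveI := kingVol_neZero L j
      |topPieceStep L a m2 j b b'| ≤ C * Real.exp (-(δ * tdistT (kingVol L j) b b')) * (((L : ℝ) ^ (-(γ / 2))) ^ j.K) := by
  obtain ⟨δ, c, hδ, hc, H⟩ := topPiece_rate_blocks (d + 1) L (Nat.succ_pos d) hLodd hL ha hm hγ0.le hγ1
  set Cu : ℝ := prop38RateConst a a (a * (2 * ((a * (1 - ((L : ℝ) ^ 2)⁻¹))⁻¹ + π ^ 2 / 48 + 1 / 3)))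
      ((π ^ 2 / 4) ^ (d + 1)) (d + 1) γ + prop38PosConst a ((π ^ 2 / 4) ^ (d + 1)) (d + 1) γ with hCu
  refine ⟨c * (Real.sqrt Cu + 1), δ, by positivity, hδ, fun j b b' => ?_⟩
  haveI := kingVol_neZero L j
  have hj := H (j.params L hLodd hL) rfl rfl j.one_le_K 1 le_rfl (kingVol L j) (kingVol_eq_sitesPerDir L hLodd hL j)
    (basePt (L ^ j.K) (kingVol L j) b) (basePt (L ^ j.K) (kingVol L j) b')
    (basePt (L ^ 1 * L ^ j.K) (kingVol L j) b) (basePt (L ^ 1 * L ^ j.K) (kingVol L j) b')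
    (basePt_over L j.K (kingVol L j) b) (basePt_over L j.K (kingVol L j) b')
  rw [blockOf_basePt, blockOf_basePt] at hj
  -- names
  set s : ℝ := (L : ℝ) ^ (-(γ / 2)) with hs_def
  have hs : 0 ≤ s := Real.rpow_nonneg (Nat.cast_nonneg _) _
  set Ck : ℝ := prop38RateConst a a (lemma43Const a L j.K 1) ((π ^ 2 / 4) ^ (d + 1)) (d + 1) γ
    + prop38PosConst a ((π ^ 2 / 4) ^ (d + 1)) (d + 1) γ with hCk
  set E : ℝ := Real.exp (-(δ * tdistT (kingVol L j) b b')) with hE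
  have hCle : Ck ≤ Cu := prop38Const_le_unif (d := d + 1) (Nat.succ_pos d) ha hL j.one_le_K le_rfl (by linarith)
  have hrate : ((L ^ j.K : ℕ) : ℝ) ^ (-γ) = (s ^ j.K) ^ 2 := by
    rw [rpow_neg_natPow, kingTheta_eq_sq, ← pow_mul, ← pow_mul, mul_comm]
  have hsqrt : Real.sqrt (Ck * ((L ^ j.K : ℕ) : ℝ) ^ (-γ)) ≤ Real.sqrt Cu * s ^ j.K := by
    rw [hrate, Real.sqrt_mul' _ (sq_nonneg _), Real.sqrt_sq (pow_nonneg hs _)]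
    exact mul_le_mul_of_nonneg_right (Real.sqrt_le_sqrt hCle) (pow_nonneg hs _)
  have hinv : ((L : ℝ) ^ j.K)⁻¹ ≤ s ^ j.K := inv_pow_le_theta_pow L (by omega) (by linarith) j.K
  have hstep : |topPieceStep L a m2 j b b'| ≤ (c * Real.sqrt (Ck * ((L ^ j.K : ℕ) : ℝ) ^ (-γ)) + c * ((L : ℝ) ^ j.K)⁻¹) * E :=
    hj
  calc |topPieceStep L a m2 j b b'|
      ≤ (c * Real.sqrt (Ck * ((L ^ j.K : ℕ) : ℝ) ^ (-γ)) + c * ((L : ℝ) ^ j.K)⁻¹) * E := hstep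
    _ ≤ (c * (Real.sqrt Cu * s ^ j.K) + c * s ^ j.K) * E := by
        refine mul_le_mul_of_nonneg_right (add_le_add ?_ ?_) (Real.exp_pos _).le
        · exact mul_le_mul_of_nonneg_left hsqrt hc.le
        · exact mul_le_mul_of_nonneg_left hinv hc.le
    _ = c * (Real.sqrt Cu + 1) * E * s ^ j.K := by ring

end Step

/-! ## §5 The layers: `NE2PlusSite` ∕ `NE2ZeroSite` and `NE2PlusOperator` ∕ `NE2ZeroOperator` for the top piece, hypothesis-free -/

section Layers

variable (L : ℕ) [NeZero L]

/-- **THE TYPED SITE INEQUALITY FOR THE TOP PIECE, UNIFORMLY** (odd `L ≥ 3`, `a, m² > 0`, `0 < γ ≤ 1`): ONE `(C, δ)` such that for EVERY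
index and (the unique) background, `EtaRateIneqSite d′ p (topPieceSite L a m² j) C δ (γ∕2)` — every exponent pair `(d′, p)` (all
sites have size `L^Kη = 1`). [cite: Balaban1985BackgroundPropagators, Thm 3.2 (3.48) p.398 (shape); King1986, Prop. 3.9 (3.73) p.665, p.675] -/
theorem etaRateIneqSite_topPiece (hLodd : Odd L) (hL : 2 ≤ L) {a m2 : ℝ} (ha : 0 < a) (hm : 0 < m2) {γ : ℝ} (hγ0 : 0 < γ)
    (hγ1 : γ ≤ 1) :
    ∃ C δ : ℝ, 0 < C ∧ 0 < δ ∧ ∀ (j : KingVolIndex d) (U : (kingVolInstance d L j).Bf.Cfg) (d' : ℕ) (p : ℝ),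
      EtaRateIneqSite d' p (topPieceSite L a m2 j) C δ (γ / 2) U := by
  obtain ⟨C, δ, hC, hδ, H⟩ := topPiece_step_le (d := d) L hLodd hL ha hm hγ0 hγ1
  refine ⟨C, δ, hC, hδ, fun j U d' p y y' => ?_⟩
  haveI := kingVol_neZero L j
  have hL0 : (0 : ℝ) < L := by exact_mod_cast Nat.pos_of_ne_zero (NeZero.ne L)
  show |topPieceStep L a m2 j y y'| ≤
    C * (torusOpGeo d (L : ℝ) j.Msz j.K (kingVol L j)).len y ^ (-p) *
      (torusOpGeo d (L : ℝ) j.Msz j.K (kingVol L j)).len y' ^ (-(d' : ℝ)) *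
      Real.exp (-(δ * (torusOpGeo d (L : ℝ) j.Msz j.K (kingVol L j)).dist y y')) *
      max (rateFactor (torusOpGeo d (L : ℝ) j.Msz j.K (kingVol L j)) (γ / 2) y)
        (rateFactor (torusOpGeo d (L : ℝ) j.Msz j.K (kingVol L j)) (γ / 2) y')
  rw [torusOpGeo_len _ hL0.ne', torusOpGeo_len _ hL0.ne', Real.one_rpow, Real.one_rpow, mul_one, mul_one,
    rateFactor_torusOpGeo _ hL0, rateFactor_torusOpGeo _ hL0, max_self, torusOpGeo_dist, ← tdistT_eq_dist]
  exact H j y y'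

/-- **`NE2PlusSite` IS INHABITED BY KING'S TOP PIECE ON THE KING-MODEL FAMILY, HYPOTHESIS-FREE** (odd `L ≥ 3`, `a, m² > 0`,
`0 < γ ≤ 1`; every `d′`, `p`, `c35`): constants `(M₅, δ, a₀, C, γ′) = (1, δ, 1, C, γ∕2)`, uniform in `(m, K, Msz)`.  HONEST SCOPE (i)–(iii).
[cite: Balaban1985BackgroundPropagators, Thm 3.2 (3.48) p.398 + Thm 3.14 pp.426–427 (quantifier template); King1986, Prop. 3.9 (3.73) p.665, p.675] -/
theorem ne2PlusSite_topPiece (hLodd : Odd L) (hL : 2 ≤ L) {a m2 : ℝ} (ha : 0 < a) (hm : 0 < m2) {γ : ℝ} (hγ0 : 0 < γ)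
    (hγ1 : γ ≤ 1) (d' : ℕ) (p c35 : ℝ) :
    NE2PlusSite d' p c35 (kingVolInstance d L) (topPieceSite L a m2) := by
  obtain ⟨C, δ, hC, hδ, H⟩ := etaRateIneqSite_topPiece (d := d) L hLodd hL ha hm hγ0 hγ1
  exact ⟨1, δ, 1, C, γ / 2, one_pos, hδ, one_pos, hC, half_pos hγ0, fun j _ _ _ _ U _ => H j U d' p⟩

/-- **`NE2ZeroSite` HOLDS FOR KING'S TOP PIECE** (same data; every `d′`, `p`). [cite: King1986, Prop. 3.9 (3.73) p.665, p.675 (A = 0 model)] -/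
theorem ne2ZeroSite_topPiece (hLodd : Odd L) (hL : 2 ≤ L) {a m2 : ℝ} (ha : 0 < a) (hm : 0 < m2) {γ : ℝ} (hγ0 : 0 < γ)
    (hγ1 : γ ≤ 1) (d' : ℕ) (p : ℝ) :
    NE2ZeroSite d' p (kingVolInstance d L) (topPieceSite L a m2) := by
  obtain ⟨C, δ, hC, hδ, H⟩ := etaRateIneqSite_topPiece (d := d) L hLodd hL ha hm hγ0 hγ1
  exact ⟨1, δ, C, γ / 2, one_pos, hδ, hC, half_pos hγ0, fun j _ => H j _ d' p⟩

/-- **`NE2PlusOperator` IS INHABITED BY KING'S TOP PIECE ON THE KING-MODEL FAMILY, HYPOTHESIS-FREE** (odd `L ≥ 3`, `a, m² > 0`,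
`0 < γ ≤ 1`; every `c35`): the four (3.42) entries of the unit-lattice operator of the η-difference kernel, constants
`(M₅, δ₀, a₀, B₀, γ′) = (1, δ, 1, 4(d+1)e^{δ}C, γ∕2)`, uniform in `(m, K, Msz)` — §4 through the two-point readout §1.  HONEST SCOPE (i)–(iii).
[cite: Balaban1985BackgroundPropagators, Thm 3.1 (3.42) p.397 + Thm 3.14 pp.426–427 (quantifier template); King1986, Prop. 3.9 (3.73) p.665, p.675] -/
theorem ne2PlusOperator_topPiece (hLodd : Odd L) (hL : 2 ≤ L) {a m2 : ℝ} (ha : 0 < a) (hm : 0 < m2) {γ : ℝ} (hγ0 : 0 < γ)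
    (hγ1 : γ ≤ 1) (c35 : ℝ) :
    NE2PlusOperator c35 (kingVolInstance d L) (topPieceOp L a m2) := by
  obtain ⟨C, δ, hC, hδ, H⟩ := topPiece_step_le (d := d) L hLodd hL ha hm hγ0 hγ1
  have hL0 : (0 : ℝ) < L := by exact_mod_cast Nat.pos_of_ne_zero (NeZero.ne L)
  refine ⟨1, δ, 1, B0op d δ C, γ / 2, one_pos, hδ, one_pos, B0op_pos d δ hC, half_pos hγ0, fun j _ _ _ _ U _ => ?_⟩
  haveI := kingVol_neZero L j
  exact etaRateIneq342_of_kernelBound₂ (N := kingVol L j) hL0 j.Msz j.K (fun y z => H j y z) hδ.le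

/-- **`NE2ZeroOperator` (the venue's `N15zero` layer) HOLDS FOR KING'S TOP PIECE** (same data). [cite: King1986, Props. 3.8–3.9 (3.71)–(3.75) pp.664–665 (A = 0 model), p.675] -/
theorem ne2ZeroOperator_topPiece (hLodd : Odd L) (hL : 2 ≤ L) {a m2 : ℝ} (ha : 0 < a) (hm : 0 < m2) {γ : ℝ} (hγ0 : 0 < γ)
    (hγ1 : γ ≤ 1) :
    NE2ZeroOperator (kingVolInstance d L) (topPieceOp L a m2) :=
  ne2Zero_of_ne2Plus (c35 := 0) (fun _ _ _ => trivial) (ne2PlusOperator_topPiece L hLodd hL ha hm hγ0 hγ1 0)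

omit [NeZero L] in
/-- THE LETTERS HAVE CONTENT: the rate `L^{−γ∕2}` of the two layers lies in `]0, 1[` (`γ > 0`, `L ≥ 2`). [folklore] -/
theorem topPiece_rate_mem_Ioo (hL : 2 ≤ L) {γ : ℝ} (hγ0 : 0 < γ) :
    0 < (L : ℝ) ^ (-(γ / 2)) ∧ (L : ℝ) ^ (-(γ / 2)) < 1 :=
  ⟨kingTheta_pos (by omega) _, kingTheta_lt_one hL (half_pos hγ0)⟩

end Layers

end Summit.QuantumFields.YangMills.BalabanUVNodes.N15KingModelRung

end
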